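import Summits.BirchSwinnertonDyer.BirchSwinnertonDyer.Theorems.EisensteinPrimesMazurMCOnCellBTwistbackTwoStepChain
import Summits.BirchSwinnertonDyer.BirchSwinnertonDyer.Theorems.EisensteinPrimesBSDpOnCellCTwistCertificate
import HarnessLib

/-!
# Crux 3 `MazurMCOnCellB` (stmt-BirchSwinnertonDyer-19033), line `twistback` v8 — ROAD (e) with the Ш-unit certificate
# read on ANY globally minimal curve `Wc` that is `ℚ`-ISOGENOUS to the far end `W″` of the two-step (Cassels): the
# partner's `BSD_p`, the stub's (∃-PARTNER) clause at `(W, p)`, and the same at ANY distance along `TwoStepAt p` chains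

Width seat bsd-line-x2-p1-w6 (gen 3), cell `bsd-eis`, 2026-08-28; LEAD g14 WORKER FIT (F1) (STATUS 21:06:47Z);
`--supports stmt-BirchSwinnertonDyer-19033 --as helper`. HONEST FRAMING: conditional theorems only; no `def`, no named
fact introduced, no `sorry`; closes no registered stub; no summit statement, no Mazur main conjecture and no BSD is proved
for any curve unconditionally; 0 cells / labels / stubs / tiers move.

## What (LEAD g14's specification, F1)

x2-p1-w6 g2's `…TwistbackTwoStepShaUnit` (p662647) §1–§2 VERBATIM with ONE change: the exact rational certificate
`ord_p #Ш_an = 0` is read NOT on the model `W″` of `Wd^{(d_{K″})}` but on ANY globally minimal `Wc` with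
`IsIsogenous W″ Wc` (extra binders `(Wc) [IsElliptic] [IsGloballyMinimal] (hiso) (hunit)`); the proof swaps crux 4's
door `Reoriented.bsdp_of_cellC_of_twistShaUnit` for its §4 twin `Reoriented.bsdp_of_cellC_of_isogenousTwistShaUnit`
(p517406 §4: `Wc` is X2 at `p`, `L(Wc,1) = L(W″,1) ≠ 0`, Wuthrich 2014 Prop. 21 at `Wc`, Cassels
`X2.bsdp_of_isIsogenous_of_bsdp` to `W″`, then the twist-partner door). WHY (idea-12 `ANCHOR-CENSUS-g8.md` §3, numbers
theirs): `v₃(#Ш_an)` is MEMBER-DEPENDENT inside the double twist's isogeny class (patterns `[0,2]`, `[0,0,2,2]`, `[2,4]`;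
the minimum sits at the OPTIMAL member in 38/38 computed classes), so a model-shaped unit datum under-counts unit ends
whenever the model `W″` handed over is not the optimal member; with this file a v9 can widen the stub's negated datum to
«unit on SOME member of the end's class», an isogeny-invariant population.

* §1 `bsdp_partner_of_twoStepIsogenousShaUnit` / `missingUpperBoundAt_partner_of_twoStepIsogenousShaUnit`: `BSDp Wd p`
  and `Typed.MissingUpperBoundAt Wd p` at the rank-one partner.
* §2 `upperPartner_at_of_twoStepIsogenousShaUnit`: the (∃-PARTNER) clause of the registered stub AT `(W, p)` VERBATIM.
* §3 (this seat's chain lineage, `…TwoStepDefs` p667979 / `…TwoStepChain` p668570): `bsdp_of_cellB_of_isogenous_shaAn_unit`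
  (an X2b pair whose CLASS carries a `p`-unit `#Ш_an` has `BSD_p` — Prop. 21 on the member + Cassels; the `BSDp` twin of
  LEAD g14's in-skeleton `mazurMC_ofClassShaUnit`), then `bsdp_…` / `mazurMainConjectureAt_…` /
  `upperPartner_at_of_cellB_of_{refl,}transGen_twoStepAt_of_isogenous_shaAn_unit` and the packed door
  `upperPartner_at_of_cellB_of_exists_transGen_isogenous_shaAn_unit`: a class-Ш-unit end REACHABLE AT ANY DISTANCE
  (`≥ 0` for `BSD(E,p)` / the main conjecture, `≥ 1` for the (∃-PARTNER) clause).

HYPOTHESES BY NAME (nothing asserted): `PublishedInputs` (stmt-…-19037), Wuthrich 2014 Prop. 21 `sha_dvd_analyticSha`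
(stub 2 (2k)), Poitou–Tate ×2 (tree THEOREMS, fed by `poitouTate_pair`), Hsieh 2014 Thm. 1, Liu–Zhang–Zhang 2018, Mazur
1978 Cor. 4.1 (PUBLISHED / refereed), Keller–Yin 2024 Thm. D (stub 3a; UNREFEREED PREPRINT). PER PAIR / PER CHAIN: fields,
models, readings as displayed + ONE exact rational `#Ш_an(Wc)` with `ord_p = 0` on an isogenous member. NO `p`-adic
`L`-function, NO height / Schneider, NO exceptional leading term, NO class number / line datum. The class-wide supply
(every X2b pair reaches such an end) is OPEN (idea-12 `UnitAnchorSupply`; LEAD g13 verdict §2 (i), §7) and NOT claimed.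

References: [Wuthrich2014] Prop. 21, Thm. 16; [MilneADT2006] Thm. I.7.3 (Cassels); [KellerYin2024] Thm. D (PRE);
[CastellaEtAl2021] Thm. 5.3.1; [LiuZhangZhang2018]; [Hsieh2014] Thm. 1; [Mazur1978] Cor. 4.1; [Miller2011LMS] Def. 1.1;
x2-p1-w6 g2 p662647 / p663790; cgshw g15 p517406 §4; idea-12 `Cruxes/MazurMCOnCellB/ANCHOR-CENSUS-g8.md` §3.
-/

set_option autoImplicit false
-- `Summit.BirchSwinnertonDyer.BirchSwinnertonDyer.…`: the summit and its single sub-problem share a name.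
set_option linter.dupNamespace false

noncomputable section

open scoped Classical MatrixGroups ModularForm

open CongruenceSubgroup WeierstrassCurve NumberField
  Literature.NumberTheory.EllipticCurves
  Literature.NumberTheory.EllipticCurves.ModularForms
  Literature.NumberTheory.QuadraticFields
  Literature.NumberTheory.EllipticCurves.Rank1Residual
  Literature.NumberTheory.EllipticCurves.Rank1Residual.Typed
  Literature.NumberTheory.EllipticCurves.Wuthrich2014
  Literature.NumberTheory.EllipticCurves.SteinWuthrich2013
  Literature.NumberTheory.EllipticCurves.GreenbergVatsal2000
  Literature.NumberTheory.EllipticCurves.KellerYin2024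
  Literature.NumberTheory.GaloisCohomology
  Summit.BirchSwinnertonDyer.Rank1Residual
  Summit.BirchSwinnertonDyer.BirchSwinnertonDyer.Theses
  Summit.BirchSwinnertonDyer.BirchSwinnertonDyer.Theorems.EisensteinPrimesMazurMCOnCellBTwistbackTwoStepDefs
  Summit.BirchSwinnertonDyer.BirchSwinnertonDyer.Theorems.EisensteinPrimesMazurMCOnCellBTwistbackOnePartnerAt
  Summit.BirchSwinnertonDyer.BirchSwinnertonDyer.Theorems.EisensteinPrimesMazurMCOnCellBTwistbackTwoStepChain

namespace Summit.BirchSwinnertonDyer.BirchSwinnertonDyer.Theorems.EisensteinPrimesMazurMCOnCellBTwistbackTwoStepIsogenousShaUnit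

/-! ## §1. The partner's `BSD(p)` from a unit certificate on a curve ISOGENOUS to the far end -/

/-- **The rank-one PARTNER is closed by a unit twist one more step away, the unit read on ANY isogenous minimal curve.**
Data: `(W, p)` an X2 pair; `K` imaginary quadratic with `p` split; `Wd` a globally minimal model of `E^{(d_K)}` with
`ord_{s=1} L(Wd, s) = 1`; `K″` admissible FOR `Wd` with `L(Wd^{(d_{K″})}, 1) ≠ 0`; `W″` a globally minimal model of
`Wd^{(d_{K″})}`; `Wc` globally minimal, `ℚ`-isogenous to `W″`, with `#Ш_an(Wc)` a rational `p`-unit. Conclusion `BSDp Wd p`: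
crux 4's door `Reoriented.bsdp_of_cellC_of_isogenousTwistShaUnit` (p517406 §4) at the X2c pair `(Wd, p)`
(`X2.classX2_twist`), value atom from LZZ, IMC atoms from Keller–Yin Thm. D. = p662647 §1 with `W″ ↦ (W″ ∼ Wc)`.
CONDITIONAL on every listed binder. [claim: KellerYin2024, status: under-review]
[cite: KellerYin2024, Thm. D = Thm. 5.1.3 (arXiv:2402.12781v2 L306–L309)] [cite: Wuthrich2014, Prop. 21 (p. 400)]
[cite: MilneADT2006, Thm. I.7.3 (Cassels)] [cite: LiuZhangZhang2018, Thms. 1.5.1 and 1.5.3]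
[cite: CastellaEtAl2021, Thm. 5.3.1 and (5.5)–(5.7)] [cite: Hsieh2014, Thm. 1] [cite: Mazur1978, Cor. 4.1] [cite: Miller2011LMS, Def. 1.1] -/
theorem bsdp_partner_of_twoStepIsogenousShaUnit (hP : EisensteinPrimes.PublishedInputs) (hW21 : sha_dvd_analyticSha)
    (hPT : ∀ (K : Type) [Field K] [NumberField K], poitouTate_selmerStructure_duality K)
    (hPT2 : ∀ (K : Type) [Field K] [NumberField K], poitouTate_sha_tateDual K)
    (hH : hsieh2014_exists_anticyclotomicPAdicLFunction)
    (hF : LiuZhangZhang2018.thm151_thm153_modularCurve_heegnerVector) (hMaz : mazur_not_dvd_maninConstant_of_odd)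
    (hD : KellerYin2024.thmD_imcMult_exists_isBDPLFunction_isTorsion_charIdeal_eq_OPEN)
    (W : WeierstrassCurve ℚ) [W.IsElliptic] [W.IsGloballyMinimal] (p : ℕ) [Fact p.Prime] (hX : ClassX2 W p)
    (K : Type) [Field K] [NumberField K] (hK : IsImaginaryQuadratic K) (hHp : SatisfiesHeegnerHypothesis p K)
    (Wd : WeierstrassCurve ℚ) [Wd.IsElliptic] [Wd.IsGloballyMinimal]
    (hWd : ∃ C : VariableChange ℚ, C • Wd = W.quadraticTwist (NumberField.discr K : ℚ))
    (hrd : Wd.analyticRank = 1)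
    (K'' : Type) [Field K''] [NumberField K''] (hK'' : IsImaginaryQuadratic K'')
    (hodd'' : Odd (NumberField.discr K'')) (hlt'' : NumberField.discr K'' < -4)
    (hHN'' : SatisfiesHeegnerHypothesis (Wd.conductorNorm ℤ) K'') (hHp'' : SatisfiesHeegnerHypothesis p K'')
    (hL'' : (Wd.quadraticTwist (NumberField.discr K'' : ℚ)).entireLFunction 1 ≠ 0)
    (W'' : WeierstrassCurve ℚ) [W''.IsElliptic] [W''.IsGloballyMinimal]
    (hW'' : ∃ C : VariableChange ℚ, C • W'' = Wd.quadraticTwist (NumberField.discr K'' : ℚ))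
    (Wc : WeierstrassCurve ℚ) [Wc.IsElliptic] [Wc.IsGloballyMinimal] (hiso : IsIsogenous W'' Wc)
    (hunit : ∃ q : ℚ, shaAn Wc = (q : ℂ) ∧ padicValRat p q = 0) : BSDp Wd p := by
  have hCassels := hP.2.1
  have hnf := hP.2.2.2.2.2.1
  have hGZ := hP.2.2.2.2.2.2.2.2.1
  have hKo := hP.2.2.2.2.2.2.2.2.2.1
  have hGZK := hP.2.2.2.2.2.2.2.2.2.2.1
  have hcd : X2.CellC Wd p := ⟨hrd, X2.classX2_twist W p hX K hK hHp Wd hWd⟩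
  exact Reoriented.bsdp_of_cellC_of_isogenousTwistShaUnit Wd p hW21 hnf hPT hPT2 hH hGZ hKo hGZK hMaz hCassels
    (fun W' _ _ _ ↦ X2.bdpValueContinuousDisplayAt_of_lzzRoadInputIoo (X2.lzzRoadInputIoo_of_thm151_thm153 hF) W' p)
    (fun W' _ _ hc' hns ↦ X2.forall_nonsplitIMCEqOnTreeIntOther_of_thmD_OPEN hD W' p hc' hns)
    (fun W' _ _ hc' hs ↦ X2.forall_splitIMCEqOnTreeIntOther_of_thmD_OPEN hD W' p hc' hs)
    hcd K'' hK'' hodd'' hlt'' hHN'' hHp'' hL'' W'' hW'' Wc hiso hunit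

/-- **The UPPER (Euler-system) half `Typed.MissingUpperBoundAt Wd p` at the rank-one partner** from §1 (`BSDp ⟹
MissingPPartAt ⟹ both halves`, `Ш(Wd)` finite by GZK). = p662647's `missingUpperBoundAt_partner_of_twoStepShaUnit` with
the unit read on `Wc ∼ W″`. CONDITIONAL. [claim: KellerYin2024, status: under-review] [cite: Wuthrich2014, Prop. 21 (p. 400)]
[cite: MilneADT2006, Thm. I.7.3] [cite: Miller2011LMS, Def. 1.1] -/
theorem missingUpperBoundAt_partner_of_twoStepIsogenousShaUnit (hP : EisensteinPrimes.PublishedInputs)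
    (hW21 : sha_dvd_analyticSha)
    (hPT : ∀ (K : Type) [Field K] [NumberField K], poitouTate_selmerStructure_duality K)
    (hPT2 : ∀ (K : Type) [Field K] [NumberField K], poitouTate_sha_tateDual K)
    (hH : hsieh2014_exists_anticyclotomicPAdicLFunction)
    (hF : LiuZhangZhang2018.thm151_thm153_modularCurve_heegnerVector) (hMaz : mazur_not_dvd_maninConstant_of_odd)
    (hD : KellerYin2024.thmD_imcMult_exists_isBDPLFunction_isTorsion_charIdeal_eq_OPEN)
    (W : WeierstrassCurve ℚ) [W.IsElliptic] [W.IsGloballyMinimal] (p : ℕ) [Fact p.Prime] (hX : ClassX2 W p)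
    (K : Type) [Field K] [NumberField K] (hK : IsImaginaryQuadratic K) (hHp : SatisfiesHeegnerHypothesis p K)
    (Wd : WeierstrassCurve ℚ) [Wd.IsElliptic] [Wd.IsGloballyMinimal]
    (hWd : ∃ C : VariableChange ℚ, C • Wd = W.quadraticTwist (NumberField.discr K : ℚ))
    (hrd : Wd.analyticRank = 1)
    (K'' : Type) [Field K''] [NumberField K''] (hK'' : IsImaginaryQuadratic K'')
    (hodd'' : Odd (NumberField.discr K'')) (hlt'' : NumberField.discr K'' < -4)
    (hHN'' : SatisfiesHeegnerHypothesis (Wd.conductorNorm ℤ) K'') (hHp'' : SatisfiesHeegnerHypothesis p K'')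
    (hL'' : (Wd.quadraticTwist (NumberField.discr K'' : ℚ)).entireLFunction 1 ≠ 0)
    (W'' : WeierstrassCurve ℚ) [W''.IsElliptic] [W''.IsGloballyMinimal]
    (hW'' : ∃ C : VariableChange ℚ, C • W'' = Wd.quadraticTwist (NumberField.discr K'' : ℚ))
    (Wc : WeierstrassCurve ℚ) [Wc.IsElliptic] [Wc.IsGloballyMinimal] (hiso : IsIsogenous W'' Wc)
    (hunit : ∃ q : ℚ, shaAn Wc = (q : ℂ) ∧ padicValRat p q = 0) : MissingUpperBoundAt Wd p := by
  have hGZK := hP.2.2.2.2.2.2.2.2.2.2.1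
  have hbsd : BSDp Wd p :=
    bsdp_partner_of_twoStepIsogenousShaUnit hP hW21 hPT hPT2 hH hF hMaz hD W p hX K hK hHp Wd hWd hrd K'' hK''
      hodd'' hlt'' hHN'' hHp'' hL'' W'' hW'' Wc hiso hunit
  haveI : Finite Wd.sha := (hGZK Wd (le_of_eq hrd)).2
  exact (lower_and_upper_of_missingPPartAt Wd p (missingPPartAt_of_bsdp Wd p hbsd)).2

/-! ## §2. The (∃-PARTNER) clause of the registered stub AT `(W, p)` -/

/-- **The stub's (∃-PARTNER) clause AT `(W, p)` from a TWO-STEP datum whose unit is read on an ISOGENOUS member** —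
both signs at `p`, every odd `p`. Data: an X2b pair `(W, p)`; `K` admissible for `W` with `ord_{s=1} L(E^{(d_K)},s) = 1`;
ONE globally minimal model `Wd` of `E^{(d_K)}`; `K″` admissible for `Wd` with `L(Wd^{(d_{K″})},1) ≠ 0`; `W″` a globally
minimal model of `Wd^{(d_{K″})}`; `Wc ∼ W″` globally minimal with `ord_p #Ш_an(Wc) = 0`. Conclusion: the partner clause
VERBATIM (witness `K`; the upper half at EVERY globally minimal model of the twist by Cassels
`X2.bsdp_of_isIsogenous_of_bsdp` along `isIsogenous_of_smul_eq`). = p662647 §2 with `W″ ↦ (W″ ∼ Wc)`. CONDITIONAL on the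
named facts; the existence of such data at every X2b pair is OPEN and not claimed.
[claim: KellerYin2024, status: under-review] [cite: KellerYin2024, Thm. D = Thm. 5.1.3 (arXiv:2402.12781v2 L306–L309)]
[cite: Wuthrich2014, Prop. 21 (p. 400)] [cite: MilneADT2006, Thm. I.7.3 (Cassels)] [cite: Miller2011LMS, Def. 1.1] -/
theorem upperPartner_at_of_twoStepIsogenousShaUnit (hP : EisensteinPrimes.PublishedInputs) (hW21 : sha_dvd_analyticSha)
    (hPT : ∀ (K : Type) [Field K] [NumberField K], poitouTate_selmerStructure_duality K)
    (hPT2 : ∀ (K : Type) [Field K] [NumberField K], poitouTate_sha_tateDual K)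
    (hH : hsieh2014_exists_anticyclotomicPAdicLFunction)
    (hF : LiuZhangZhang2018.thm151_thm153_modularCurve_heegnerVector) (hMaz : mazur_not_dvd_maninConstant_of_odd)
    (hD : KellerYin2024.thmD_imcMult_exists_isBDPLFunction_isTorsion_charIdeal_eq_OPEN)
    (W : WeierstrassCurve ℚ) [W.IsElliptic] [W.IsGloballyMinimal] (p : ℕ) [Fact p.Prime] (hc : X2.CellB W p)
    (K : Type) [Field K] [NumberField K] (hK : IsImaginaryQuadratic K)
    (hHN : SatisfiesHeegnerHypothesis (W.conductorNorm ℤ) K) (hHp : SatisfiesHeegnerHypothesis p K)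
    (hoddK : Odd (NumberField.discr K)) (hlt : NumberField.discr K < -4)
    (hr1 : (W.quadraticTwist (NumberField.discr K : ℚ)).analyticRank = 1)
    (Wd : WeierstrassCurve ℚ) [Wd.IsElliptic] [Wd.IsGloballyMinimal]
    (hWd : ∃ C : VariableChange ℚ, C • Wd = W.quadraticTwist (NumberField.discr K : ℚ))
    (K'' : Type) [Field K''] [NumberField K''] (hK'' : IsImaginaryQuadratic K'')
    (hodd'' : Odd (NumberField.discr K'')) (hlt'' : NumberField.discr K'' < -4)
    (hHN'' : SatisfiesHeegnerHypothesis (Wd.conductorNorm ℤ) K'') (hHp'' : SatisfiesHeegnerHypothesis p K'')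
    (hL'' : (Wd.quadraticTwist (NumberField.discr K'' : ℚ)).entireLFunction 1 ≠ 0)
    (W'' : WeierstrassCurve ℚ) [W''.IsElliptic] [W''.IsGloballyMinimal]
    (hW'' : ∃ C : VariableChange ℚ, C • W'' = Wd.quadraticTwist (NumberField.discr K'' : ℚ))
    (Wc : WeierstrassCurve ℚ) [Wc.IsElliptic] [Wc.IsGloballyMinimal] (hiso : IsIsogenous W'' Wc)
    (hunit : ∃ q : ℚ, shaAn Wc = (q : ℂ) ∧ padicValRat p q = 0) :
    ∃ (K : Type) (_ : Field K) (_ : NumberField K), IsImaginaryQuadratic K ∧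
      SatisfiesHeegnerHypothesis (W.conductorNorm ℤ) K ∧ SatisfiesHeegnerHypothesis p K ∧
      Odd (NumberField.discr K) ∧ NumberField.discr K < -4 ∧
      (W.quadraticTwist (NumberField.discr K : ℚ)).analyticRank = 1 ∧
      ∀ (Wd : WeierstrassCurve ℚ) [Wd.IsElliptic] [Wd.IsGloballyMinimal],
        (∃ C : VariableChange ℚ, C • Wd = W.quadraticTwist (NumberField.discr K : ℚ)) →
        MissingUpperBoundAt Wd p := by
  have hCassels := hP.2.1
  have hnf := hP.2.2.2.2.2.1
  have hGZK := hP.2.2.2.2.2.2.2.2.2.2.1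
  have hE : WeierstrassCurve.hasEntireLFunction_rat :=
    WeierstrassCurve.hasEntireLFunction_rat_of_exists_isNewformOf hnf
  obtain ⟨C, hC⟩ := hWd
  have hrd : Wd.analyticRank = 1 := by
    have h := congrArg WeierstrassCurve.analyticRank hC
    rw [analyticRank_smul] at h
    exact h.trans hr1
  have hbsd : BSDp Wd p :=
    bsdp_partner_of_twoStepIsogenousShaUnit hP hW21 hPT hPT2 hH hF hMaz hD W p hc.2.1 K hK hHp Wd ⟨C, hC⟩ hrd K''
      hK'' hodd'' hlt'' hHN'' hHp'' hL'' W'' hW'' Wc hiso hunit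
  refine ⟨K, inferInstance, inferInstance, hK, hHN, hHp, hoddK, hlt, hr1, fun Wd' _ _ hWd' ↦ ?_⟩
  obtain ⟨C', hC'⟩ := hWd'
  have hrd' : Wd'.analyticRank = 1 := by
    have h := congrArg WeierstrassCurve.analyticRank hC'
    rw [analyticRank_smul] at h
    exact h.trans hr1
  have hiso' : IsIsogenous Wd Wd' := (isIsogenous_of_smul_eq hC).trans' (isIsogenous_of_smul_eq' hC')
  have hbsd' : BSDp Wd' p :=
    X2.bsdp_of_isIsogenous_of_bsdp hCassels hGZK hE Wd Wd' hiso' p (le_of_eq hrd) hbsd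
  haveI : Finite Wd'.sha := (hGZK Wd' (le_of_eq hrd')).2
  exact (lower_and_upper_of_missingPPartAt Wd' p (missingPPartAt_of_bsdp Wd' p hbsd')).2

/-! ## §3. Along chains: a class-Ш-unit end reachable at any distance -/

/-- **An X2b pair whose `ℚ`-isogeny CLASS carries a `p`-unit analytic Ш has `BSD(E,p)`** (the `BSDp` twin of LEAD
g14's in-skeleton `mazurMC_ofClassShaUnit`): for `(W, p)` X2b and `Wc ∼ W` globally minimal with `#Ш_an(Wc)` a rational
`p`-unit — `Wc` has `L(Wc,1) = L(W,1) ≠ 0` (`entireLFunction_eq_of_isIsogenous'`), reducible `E[p]`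
(`not_hasIrreducibleModPGaloisRep_of_isIsogenous`) and multiplicative reduction at `p`
(`hasMultiplicativeReductionAt_of_isIsogenous`), so Wuthrich 2014 Prop. 21 gives `BSDp Wc p`
(`Wuthrich2014.bsdp_of_L_one_ne_zero_of_padicValRat_shaAn_eq_zero`) and Cassels (`X2.bsdp_of_isIsogenous_of_bsdp`) moves
it to `W`. Named facts: Prop. 21, GZK, modularity, Cassels (`PublishedInputs` conjuncts). CONDITIONAL.
[cite: Wuthrich2014, Prop. 21 (p. 400)] [cite: MilneADT2006, Thm. I.7.3 (Cassels)] [cite: Miller2011LMS, Def. 1.1] -/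
theorem bsdp_of_cellB_of_isogenous_shaAn_unit (hP : EisensteinPrimes.PublishedInputs) (hW21 : sha_dvd_analyticSha)
    {p : ℕ} [Fact p.Prime] {W : WeierstrassCurve ℚ} [W.IsElliptic] [W.IsGloballyMinimal] (hc : X2.CellB W p)
    (Wc : WeierstrassCurve ℚ) [Wc.IsElliptic] [Wc.IsGloballyMinimal] (hiso : IsIsogenous W Wc)
    (hunit : ∃ q : ℚ, shaAn Wc = (q : ℂ) ∧ padicValRat p q = 0) : BSDp W p := by
  have hp : p.Prime := Fact.out
  have hCassels := hP.2.1
  have hnf := hP.2.2.2.2.2.1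
  have hGZK := hP.2.2.2.2.2.2.2.2.2.2.1
  have hE : WeierstrassCurve.hasEntireLFunction_rat :=
    WeierstrassCurve.hasEntireLFunction_rat_of_exists_isNewformOf hnf
  have hL : W.entireLFunction 1 ≠ 0 := (W.analyticRank_eq_zero_iff_holds (hE W)).1 hc.1
  have hLc : Wc.entireLFunction 1 ≠ 0 := by
    rw [← entireLFunction_eq_of_isIsogenous' hiso]; exact hL
  have hredc : ¬ Wc.HasIrreducibleModPGaloisRep p := not_hasIrreducibleModPGaloisRep_of_isIsogenous hiso hc.2.1.2.1
  have hmultc : Wc.HasMultiplicativeReductionAtPrime p := by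
    have hb := WeierstrassCurve.hasMultiplicativeReductionAtPrime_iff_hasMultiplicativeReductionAt_holds
    have h1 : W.HasMultiplicativeReductionAt
        ((Rat.HeightOneSpectrum.primesEquiv (R := ℤ)).symm ⟨p, hp⟩) := (hb W ⟨p, hp⟩).mp hc.2.1.2.2
    exact (hb Wc ⟨p, hp⟩).mpr (hasMultiplicativeReductionAt_of_isIsogenous hiso _ h1)
  have hbsdc : BSDp Wc p :=
    Wuthrich2014.bsdp_of_L_one_ne_zero_of_padicValRat_shaAn_eq_zero hW21 hGZK Wc p hc.2.1.1 hLc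
      (WeierstrassCurve.HasMultiplicativeReduction.not_hasAdditiveReduction (R := ℤ_[p]) hmultc) (Or.inl hredc) hunit
  have hrc : Wc.analyticRank = 0 := (Wc.analyticRank_eq_zero_iff_holds (hE _)).2 hLc
  exact X2.bsdp_of_isIsogenous_of_bsdp hCassels hGZK hE Wc W hiso.symm_of_charZero p (by rw [hrc]; exact zero_le_one)
    hbsdc

/-- **`BSD(E,p)` at an X2b pair from a CLASS-Ш-unit end reachable along a chain** (length `≥ 0`): the far end `W″` is
X2b (`cellB_of_cellB_of_reflTransGen_twoStepAt`), `bsdp_of_cellB_of_isogenous_shaAn_unit` at `(W″, Wc)`, then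
`…TwoStepChain.bsdp_of_cellB_of_reflTransGen_twoStepAt_of_bsdp`. CONDITIONAL on the named facts.
[claim: KellerYin2024, status: under-review] [cite: Wuthrich2014, Prop. 21 (p. 400)] [cite: MilneADT2006, Thm. I.7.3]
[cite: KellerYin2024, Thm. D = Thm. 5.1.3] [cite: Miller2011LMS, Def. 1.1] -/
theorem bsdp_of_cellB_of_reflTransGen_twoStepAt_of_isogenous_shaAn_unit (hP : EisensteinPrimes.PublishedInputs)
    (hW21 : sha_dvd_analyticSha)
    (hPT : ∀ (K : Type) [Field K] [NumberField K], poitouTate_selmerStructure_duality K)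
    (hPT2 : ∀ (K : Type) [Field K] [NumberField K], poitouTate_sha_tateDual K)
    (hH : hsieh2014_exists_anticyclotomicPAdicLFunction)
    (hF : LiuZhangZhang2018.thm151_thm153_modularCurve_heegnerVector) (hMaz : mazur_not_dvd_maninConstant_of_odd)
    (hD : KellerYin2024.thmD_imcMult_exists_isBDPLFunction_isTorsion_charIdeal_eq_OPEN)
    {p : ℕ} [Fact p.Prime] {W W'' : WeierstrassCurve ℚ} [W.IsElliptic] [W.IsGloballyMinimal]
    [W''.IsElliptic] [W''.IsGloballyMinimal] (hc : X2.CellB W p)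
    (h : Relation.ReflTransGen (TwoStepAt p) W W'')
    (Wc : WeierstrassCurve ℚ) [Wc.IsElliptic] [Wc.IsGloballyMinimal] (hiso : IsIsogenous W'' Wc)
    (hunit : ∃ q : ℚ, shaAn Wc = (q : ℂ) ∧ padicValRat p q = 0) : BSDp W p := by
  have hnf := hP.2.2.2.2.2.1
  have hE : WeierstrassCurve.hasEntireLFunction_rat :=
    WeierstrassCurve.hasEntireLFunction_rat_of_exists_isNewformOf hnf
  have hc'' : X2.CellB W'' p := cellB_of_cellB_of_reflTransGen_twoStepAt hE hc h
  exact bsdp_of_cellB_of_reflTransGen_twoStepAt_of_bsdp hP hPT hPT2 hH hF hMaz hD hc h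
    (bsdp_of_cellB_of_isogenous_shaAn_unit hP hW21 hc'' Wc hiso hunit)

/-- **Mazur's main conjecture at an X2b pair from a CLASS-Ш-unit end reachable along a chain** (length `≥ 0`; at length
`0` this is LEAD g14's `mazurMC_ofClassShaUnit` = Prop. 21 on an isogenous member + Cassels). CONDITIONAL; a main
conjecture is proved for no curve. [claim: KellerYin2024, status: under-review]
[cite: Wuthrich2014, Thm. 16 (p. 397) and Prop. 21 (p. 400)] [cite: SteinWuthrich2013, Thm. 6.1 (p. 20)] -/
theorem mazurMainConjectureAt_of_cellB_of_reflTransGen_twoStepAt_of_isogenous_shaAn_unit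
    (hP : EisensteinPrimes.PublishedInputs) (hW21 : sha_dvd_analyticSha)
    (hPT : ∀ (K : Type) [Field K] [NumberField K], poitouTate_selmerStructure_duality K)
    (hPT2 : ∀ (K : Type) [Field K] [NumberField K], poitouTate_sha_tateDual K)
    (hH : hsieh2014_exists_anticyclotomicPAdicLFunction)
    (hF : LiuZhangZhang2018.thm151_thm153_modularCurve_heegnerVector) (hMaz : mazur_not_dvd_maninConstant_of_odd)
    (hD : KellerYin2024.thmD_imcMult_exists_isBDPLFunction_isTorsion_charIdeal_eq_OPEN)
    {p : ℕ} [Fact p.Prime] {W W'' : WeierstrassCurve ℚ} [W.IsElliptic] [W.IsGloballyMinimal]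
    [W''.IsElliptic] [W''.IsGloballyMinimal] (hc : X2.CellB W p)
    (h : Relation.ReflTransGen (TwoStepAt p) W W'')
    (Wc : WeierstrassCurve ℚ) [Wc.IsElliptic] [Wc.IsGloballyMinimal] (hiso : IsIsogenous W'' Wc)
    (hunit : ∃ q : ℚ, shaAn Wc = (q : ℂ) ∧ padicValRat p q = 0) : X2.MazurMainConjectureAt W p := by
  have hnf := hP.2.2.2.2.2.1
  have hE : WeierstrassCurve.hasEntireLFunction_rat :=
    WeierstrassCurve.hasEntireLFunction_rat_of_exists_isNewformOf hnf
  have hc'' : X2.CellB W'' p := cellB_of_cellB_of_reflTransGen_twoStepAt hE hc h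
  exact mazurMainConjectureAt_of_cellB_of_reflTransGen_twoStepAt_of_bsdp hP hPT hPT2 hH hF hMaz hD hc h
    (bsdp_of_cellB_of_isogenous_shaAn_unit hP hW21 hc'' Wc hiso hunit)

/-- **The stub's (∃-PARTNER) clause AT `(W, p)` from a CLASS-Ш-unit end reachable at distance `≥ 1`**
(`Relation.TransGen`; witness = the first edge's `K`): `bsdp_of_cellB_of_isogenous_shaAn_unit` at the far end, then
`…TwoStepChain.upperPartner_at_of_cellB_of_transGen_twoStepAt_of_bsdp`. At distance exactly `1` this is §2.
CONDITIONAL on the named facts. [claim: KellerYin2024, status: under-review] [cite: Wuthrich2014, Prop. 21 (p. 400)]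
[cite: MilneADT2006, Thm. I.7.3] [cite: KellerYin2024, Thm. D = Thm. 5.1.3] [cite: Miller2011LMS, Def. 1.1] -/
theorem upperPartner_at_of_cellB_of_transGen_twoStepAt_of_isogenous_shaAn_unit (hP : EisensteinPrimes.PublishedInputs)
    (hW21 : sha_dvd_analyticSha)
    (hPT : ∀ (K : Type) [Field K] [NumberField K], poitouTate_selmerStructure_duality K)
    (hPT2 : ∀ (K : Type) [Field K] [NumberField K], poitouTate_sha_tateDual K)
    (hH : hsieh2014_exists_anticyclotomicPAdicLFunction)
    (hF : LiuZhangZhang2018.thm151_thm153_modularCurve_heegnerVector) (hMaz : mazur_not_dvd_maninConstant_of_odd)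
    (hD : KellerYin2024.thmD_imcMult_exists_isBDPLFunction_isTorsion_charIdeal_eq_OPEN)
    {p : ℕ} [Fact p.Prime] {W W'' : WeierstrassCurve ℚ} [W.IsElliptic] [W.IsGloballyMinimal]
    [W''.IsElliptic] [W''.IsGloballyMinimal] (hc : X2.CellB W p)
    (h : Relation.TransGen (TwoStepAt p) W W'')
    (Wc : WeierstrassCurve ℚ) [Wc.IsElliptic] [Wc.IsGloballyMinimal] (hiso : IsIsogenous W'' Wc)
    (hunit : ∃ q : ℚ, shaAn Wc = (q : ℂ) ∧ padicValRat p q = 0) :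
    ∃ (K : Type) (_ : Field K) (_ : NumberField K), IsImaginaryQuadratic K ∧
      SatisfiesHeegnerHypothesis (W.conductorNorm ℤ) K ∧ SatisfiesHeegnerHypothesis p K ∧
      Odd (NumberField.discr K) ∧ NumberField.discr K < -4 ∧
      (W.quadraticTwist (NumberField.discr K : ℚ)).analyticRank = 1 ∧
      ∀ (Wd : WeierstrassCurve ℚ) [Wd.IsElliptic] [Wd.IsGloballyMinimal],
        (∃ C : VariableChange ℚ, C • Wd = W.quadraticTwist (NumberField.discr K : ℚ)) →
        MissingUpperBoundAt Wd p := by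
  have hnf := hP.2.2.2.2.2.1
  have hE : WeierstrassCurve.hasEntireLFunction_rat :=
    WeierstrassCurve.hasEntireLFunction_rat_of_exists_isNewformOf hnf
  have hc'' : X2.CellB W'' p := cellB_of_cellB_of_reflTransGen_twoStepAt hE hc h.to_reflTransGen
  exact upperPartner_at_of_cellB_of_transGen_twoStepAt_of_bsdp hP hPT hPT2 hH hF hMaz hD hc h
    (bsdp_of_cellB_of_isogenous_shaAn_unit hP hW21 hc'' Wc hiso hunit)

/-- **The door a «no REACHABLE class-Ш-unit end» reshape would call** (excluded-branch shape): at an X2b pair `(W, p)`,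
«some `W″` reachable at distance `≥ 1` along `TwoStepAt p` has a globally minimal `ℚ`-isogenous `Wc` with `#Ш_an(Wc)` a
rational `p`-unit» gives the stub's (∃-PARTNER) clause at `(W, p)`. The v7/v8 two-step datum (unit ON the model `W″`)
is the special case `Wc = W″`, distance `1`. CONDITIONAL on the named facts; whether to register the widened negation is
the LEAD's call. [claim: KellerYin2024, status: under-review] [cite: Wuthrich2014, Prop. 21 (p. 400)]
[cite: MilneADT2006, Thm. I.7.3] [cite: Miller2011LMS, Def. 1.1] -/
theorem upperPartner_at_of_cellB_of_exists_transGen_isogenous_shaAn_unit (hP : EisensteinPrimes.PublishedInputs)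
    (hW21 : sha_dvd_analyticSha)
    (hPT : ∀ (K : Type) [Field K] [NumberField K], poitouTate_selmerStructure_duality K)
    (hPT2 : ∀ (K : Type) [Field K] [NumberField K], poitouTate_sha_tateDual K)
    (hH : hsieh2014_exists_anticyclotomicPAdicLFunction)
    (hF : LiuZhangZhang2018.thm151_thm153_modularCurve_heegnerVector) (hMaz : mazur_not_dvd_maninConstant_of_odd)
    (hD : KellerYin2024.thmD_imcMult_exists_isBDPLFunction_isTorsion_charIdeal_eq_OPEN)
    (W : WeierstrassCurve ℚ) [W.IsElliptic] [W.IsGloballyMinimal] (p : ℕ) [Fact p.Prime] (hc : X2.CellB W p)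
    (he : ∃ (W'' : WeierstrassCurve ℚ) (_ : W''.IsElliptic) (_ : W''.IsGloballyMinimal)
      (Wc : WeierstrassCurve ℚ) (_ : Wc.IsElliptic) (_ : Wc.IsGloballyMinimal),
      Relation.TransGen (TwoStepAt p) W W'' ∧ IsIsogenous W'' Wc ∧
      ∃ q : ℚ, shaAn Wc = (q : ℂ) ∧ padicValRat p q = 0) :
    ∃ (K : Type) (_ : Field K) (_ : NumberField K), IsImaginaryQuadratic K ∧
      SatisfiesHeegnerHypothesis (W.conductorNorm ℤ) K ∧ SatisfiesHeegnerHypothesis p K ∧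
      Odd (NumberField.discr K) ∧ NumberField.discr K < -4 ∧
      (W.quadraticTwist (NumberField.discr K : ℚ)).analyticRank = 1 ∧
      ∀ (Wd : WeierstrassCurve ℚ) [Wd.IsElliptic] [Wd.IsGloballyMinimal],
        (∃ C : VariableChange ℚ, C • Wd = W.quadraticTwist (NumberField.discr K : ℚ)) →
        MissingUpperBoundAt Wd p := by
  obtain ⟨W'', _, _, Wc, _, _, h, hiso, hunit⟩ := he
  exact upperPartner_at_of_cellB_of_transGen_twoStepAt_of_isogenous_shaAn_unit hP hW21 hPT hPT2 hH hF hMaz hD hc h Wc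
    hiso hunit

/-- **Mazur's main conjecture at `(W, p)` from the packed hypothesis «a class-Ш-unit end is reachable at distance
`≥ 0`»** (the empty chain = LEAD g14's class-Ш-unit population). The composition shape that tests this BEFORE the
partner road. CONDITIONAL; a main conjecture is proved for no curve. [claim: KellerYin2024, status: under-review]
[cite: Wuthrich2014, Thm. 16 (p. 397) and Prop. 21 (p. 400)] [cite: MilneADT2006, Thm. I.7.3] -/
theorem mazurMainConjectureAt_of_cellB_of_exists_reflTransGen_isogenous_shaAn_unit
    (hP : EisensteinPrimes.PublishedInputs) (hW21 : sha_dvd_analyticSha)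
    (hPT : ∀ (K : Type) [Field K] [NumberField K], poitouTate_selmerStructure_duality K)
    (hPT2 : ∀ (K : Type) [Field K] [NumberField K], poitouTate_sha_tateDual K)
    (hH : hsieh2014_exists_anticyclotomicPAdicLFunction)
    (hF : LiuZhangZhang2018.thm151_thm153_modularCurve_heegnerVector) (hMaz : mazur_not_dvd_maninConstant_of_odd)
    (hD : KellerYin2024.thmD_imcMult_exists_isBDPLFunction_isTorsion_charIdeal_eq_OPEN)
    (W : WeierstrassCurve ℚ) [W.IsElliptic] [W.IsGloballyMinimal] (p : ℕ) [Fact p.Prime] (hc : X2.CellB W p)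
    (he : ∃ (W'' : WeierstrassCurve ℚ) (_ : W''.IsElliptic) (_ : W''.IsGloballyMinimal)
      (Wc : WeierstrassCurve ℚ) (_ : Wc.IsElliptic) (_ : Wc.IsGloballyMinimal),
      Relation.ReflTransGen (TwoStepAt p) W W'' ∧ IsIsogenous W'' Wc ∧
      ∃ q : ℚ, shaAn Wc = (q : ℂ) ∧ padicValRat p q = 0) :
    X2.MazurMainConjectureAt W p := by
  obtain ⟨W'', _, _, Wc, _, _, h, hiso, hunit⟩ := he
  exact mazurMainConjectureAt_of_cellB_of_reflTransGen_twoStepAt_of_isogenous_shaAn_unit hP hW21 hPT hPT2 hH hF hMaz hD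
    hc h Wc hiso hunit

end Summit.BirchSwinnertonDyer.BirchSwinnertonDyer.Theorems.EisensteinPrimesMazurMCOnCellBTwistbackTwoStepIsogenousShaUnit

end
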